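import Literature.MathematicalPhysics.QuantumFieldTheory.BalabanImbrieJaffe1984to88.BIJ85BlockAveragesTorus
import Literature.MathematicalPhysics.QuantumFieldTheory.BalabanImbrieJaffe1984to88.BIJ88Sect4Statements
import Literature.MathematicalPhysics.QuantumFieldTheory.BalabanImbrieJaffe1984to88.BIJ85Eq453GaugeField
import Literature.MathematicalPhysics.QuantumFieldTheory.Balaban1983to89.B7SectAStatements

/-!
# `BalabanImbrieJaffe1984to88.BIJ88BlockGauge417` — T. Bałaban, J. Imbrie, A. Jaffe, *Effective action and cluster properties of the
abelian Higgs model*, Commun. Math. Phys. **114** (1988) 257–315 [BalabanImbrieJaffe1988], (4.17) p. 277 [PDF 21]: **block field gauge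
invariance of the renormalization transformation (3.11) — one renormalization step on the torus of record, PROVED.**

statement-level skeleton of published theorems with citation tags; proofs where landed; nothing here is a claim about the Yang–Mills mass gap

THE PRINT (p. 277, verbatim).  *"The second kind of gauge invariance is called block field gauge invariance, and is invariance under
u_b → u_be^{−ie_k(∂λ)(b)}, φ(x) → e^{ie_kλ(x)}, u_b^{(j)} → u_b^{(j)} exp[−ie_kL^jη(∂^{L^jη}Q′*_{k−j}λ)(b)], if b ∈ Λ₁^{(j)*c}, u_b^{(j)} → u_b^{(j)},
otherwise, (4.17) for λ a function on T₁^{(k)}. Here Q′_k denotes the averaging operator for real-valued functions on sites. […] Here,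
however, the variables u and u^{(j)} are also transformed, but in a way that does not affect the δ-functions giving the axial gauge
conditions and gauge field renormalization transformations."*

WHAT IS PROVED HERE (one step `T^{(j)} → T^{(j+1)}` of `Balaban1983to89.Setup`, standing range `j + 1 ≤ m + K`, exempt region
`Λ₁^{(j)*} = ∅` — the situation of the first step (3.11); the typed transformation is r18's `BIJ88Sect4Statements.blockGaugeUj`, the block
averages are the concrete (2.6)/(2.10) of [BalabanImbrieJaffe1985] of r18's `BIJ85BlockAveragesTorus`, the δ-functions are r18's
`BIJ88RenormTransf311.DeltaAx`/`axialMeasure` and the push-forward reading `IsRT311` of (3.11)):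
* §1 `Q′*` IS THE PULL-BACK TO BLOCKS: the adjoint of the site average `Q′` (`LatticeFieldCalculus.siteAvg`) for the pairings (2.2)
  is `(Q′*μ)(x) = μ(y_x)`, `y_x` the block of `x` (`sitePairing_siteAvg`); hence the third line of (4.17) multiplies `u_b` by
  `exp[−ie_k(μ(y_{b₊}) − μ(y_{b₋}))]` — the GAUGE TRANSFORMATION of `u` by the block-constant gauge function `x ↦ e^{ie_kλ(y_x)}`
  (`blockGaugeUj_eq_cfg_gaugeAct`; only the bonds crossing a block face move, `blockGaugeUj_of_blockOf_eq`), while the first line is the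
  gauge transformation of the block fields `(v, ψ)` by `y ↦ e^{ie_kλ(y)}` (`bgGaugeU_one_eq_cfg_gaugeAct`, `bgGaugePhi_eq_twist`).
* §2 *"does not affect the δ-functions giving the axial gauge conditions"*: a block-constant gauge transformation fixes every tree bond
  variable (the trees (3.4) are intra-block), so `δ_{Ax}(u^{g∘y}) ⇔ δ_{Ax}(u)` (`deltaAx_gaugeAct_blockConst`, any gauge group), it commutes
  with the freezing map `u ↦ u[T := 1]` (`fixBonds_gaugeAct_blockConst`) and preserves the measure `∫𝒟u δ_{Ax}(u)(·)`
  (`map_gaugeAct_blockConst_axialMeasure`, from the invariance of the product Haar measure `measurePreserving_gaugeAct`).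
* §3 *"and gauge field renormalization transformations"*: `Q(u^{g∘y}) = (Qu)^g` (`qU_gaugeAct_blockConst`: `δ(v/Qu)` is invariant when `v`
  and `u` are transformed together), `Q(u^{g∘y})((g∘y)φ) = g·Q(u)φ` (`qCov_gaugeAct_blockConst`) and the `ψ`-Gaussian `δ_H`-factor of (3.11)
  is invariant under the simultaneous rotation of `ψ` and of its centre (`gaussWeight_twist`).
* §4 **THE THEOREM** (`isRT311_blockGauge`): for EVERY jointly gauge-invariant density `ρ₀(u, φ)` and every `ρ₁` that (3.11) defines from
  it (`IsRT311 qU qCov a ρ₀ ρ₁`), the block-gauge transformed density `(v, ψ) ↦ ρ₁(v^g, gψ)` satisfies (3.11) for the same `ρ₀` — the change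
  of variables `u → u^{g∘y}`, `φ → (g∘y)φ`, `ψ → gψ`, `v → v^g` under which `𝒟u δ_{Ax}`, `𝒟φ`, `dψ`, `dv` are invariant (§2, p34's
  `BIJ85RT33.measurePreserving_twist` via r18's `rotField`, `measurePreserving_gaugeAct`).  Instance: the constructed density of the printed
  model (`BIJ85BlockAveragesTorus.isRT311_printed`) — `isRT311_printed_blockGauge`.
NOT DONE HERE (honest scope): [v1: the clause *"the above transformations induce the gauge transformation u_{k,b} → u_{k,b}exp[−ie_kη(∂^ηQ′*_kλ)]"*
(it concerns the background field (4.2) built from `Q^{s*}_k`, seat p31's objects) — DONE in v1.2 over p31's `qsstarG`]; the later steps with a non-empty exempt region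
`Λ₁^{(j)*}` and the fields `u^{(j)}` of Sect. 5 (r16's part); pointwise (rather than (3.11)-level) invariance of a chosen version of `ρ₁`.
Imports: `BIJ85BlockAveragesTorus`, `BIJ88Sect4Statements` (Literature + Mathlib); theorems only; standard axioms.

v1.1 (append-only, same seat): §5 — **(3.11) determines `ρ₁^L` almost everywhere** (`isRT311_unique`: two `dv dψ`-integrable (3.11)-densities
of the same `ρ₀` agree a.e.; indicators as test functions + Fubini), the block field gauge transformations preserve `dv dψ`
(`measurePreserving_blockGauge`), hence **the constructed density is block-gauge invariant almost everywhere**: `ρ₁^L(v^g, gψ) = ρ₁^L(v, ψ)`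
for `dv dψ`-a.e. `(v, ψ)` (`rt_blockGauge_ae_eq`; `ρ₀` jointly measurable, jointly gauge invariant, `𝒟u𝒟φ`-integrable).  Nothing of v1 is changed.

v1.2 (append-only, same seat): §6 — the clause *"the above transformations induce the gauge transformation u_{k,b} →
u_{k,b}exp[−ie_kη(∂^ηQ′*_kλ)]"* for the background part of (4.2): over p31's group-level `Q^{s*}` ([2] (4.5.3),
`BIJ85Eq453GaugeField.qsstarG`/`qsstarGIter`, gauge covariance `qsstarG_gaugeAct`/`qsstarGIter_gaugeAct`), `v ↦ v^g` with `g = e^{ie_kλ}`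
transforms r18's `backgroundU` exactly by the third line of (4.17) with `Q′*_k` = pull-back along `blockOfIter k`
(`backgroundU_blockGauge`, `backgroundU_blockGauge_iter`; the correction term of (4.2) is gauge invariant, `fieldStrength_plaqVar_gaugeAct`).
v1.2 adds the imports `BIJ85Eq453GaugeField`, `B7SectAStatements`; nothing of v1/v1.1 is changed.
-/

namespace Literature.MathematicalPhysics.QuantumFieldTheory.BalabanImbrieJaffe1984to88.BIJ88BlockGauge417

open Literature.MathematicalPhysics.QuantumFieldTheory.Balaban1983to89
open BIJ88Sect3Statements (U1 toC toC_mul toC_one toC_inv norm_toC cfg gaugeU plaqVar plaqVar_gauge fieldStrength)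
open BIJ88Sect3Rescaling (toC_injective_U1)
open BIJ85Sect1Model (HiggsField)
open BIJ85RT33 (JointInvariant twist twist_apply measurable_twist)
open BIJ88RenormTransf311 (IsAxialBond axialBonds mem_axialBonds DeltaAx axialMeasure IsRT311 rho0 gaussWeight blockOf_tgt rotField
  rotField_apply measurePreserving_rotField)
open BIJ85BlockAveragesTorus (qU qCov corner blockOf_corner qU_gaugeAct qCov_gaugeAct expU1 toC_expU1 toC_gaugeAct toC_inv' toC_ne_zero
  torusRTData isRT311_printed)
open BIJ88RT311Exists (gaussApprox)
open BIJ88Sect4Statements (bgGaugeU bgGaugePhi blockGaugeUj backgroundU)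
open B7SectAStatements (blockOfIter)
open T4AxialGaugeFixing (fixBonds measurable_fixBonds fixBonds_apply_of_mem fixBonds_apply_of_not_mem)
open GaugeField (gaugeAct)
open scoped BigOperators
open _root_.MeasureTheory Complex Finset

noncomputable section

variable {P : Params} {j : ℕ}

/-! ## §1 `Q′*` is the pull-back to blocks; (4.17) is a pair of gauge transformations -/

/-- **`Q′*` for one step is the pull-back to blocks.**  With the pairings (2.2) — weight `w` per site on the coarse lattice and `wL^{−d}`
(one factor `η^d = L^{−d}` per level) on the fine lattice — the adjoint of the site average `(Q′λ)(y) = L^{−d}Σ_{x∈B(y)}λ(x)` is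
`(Q′*μ)(x) = μ(y_x)`: `⟨Q′λ, μ⟩ = ⟨λ, μ∘y⟩` (p. 277: *"Here Q′_k denotes the averaging operator for real-valued functions on sites"*;
standing range). [cite: BalabanImbrieJaffe1988, (4.17) p.277] -/
theorem sitePairing_siteAvg (hj : j + 1 ≤ P.m + P.K) (w : ℝ) (lam : Balaban1983to89.Site P j → ℝ)
    (μ : Balaban1983to89.Site P (j+1) → ℝ) :
    LatticeFieldCalculus.sitePairing w (LatticeFieldCalculus.siteAvg lam) μ =
      LatticeFieldCalculus.sitePairing (w * ((P.L : ℝ) ^ P.d)⁻¹) lam (fun x => μ (blockOf x)) := by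
  simp only [LatticeFieldCalculus.sitePairing, LatticeFieldCalculus.siteAvg_eq_blockSum hj, smul_eq_mul]
  rw [← sum_fiberwise_of_maps_to (s := (univ : Finset (Balaban1983to89.Site P j))) (t := univ) (g := blockOf) fun x _ => mem_univ _]
  refine sum_congr rfl fun y _ => ?_
  change _ = Finset.sum (block y) _
  rw [mul_sum, sum_mul, mul_sum]
  refine sum_congr rfl fun x hx => ?_
  rw [BIJ85BlockAveragesTorus.mem_block_iff.1 hx]
  ring

/-- The first line of (4.17), gauge field half, on the unit lattice (`η = 1`): `v_b → v_be^{−ie_k(∂λ)(b)}` IS the gauge transformation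
`v ↦ v^g` of `Setup` by `g(y) = e^{ie_kλ(y)} ∈ U(1)`, read in `ℂ`. [cite: BalabanImbrieJaffe1988, (4.17) p.277] -/
theorem bgGaugeU_one_eq_cfg_gaugeAct (ek : ℝ) (lam : Balaban1983to89.Site P j → ℝ) (U : GaugeField P j U1) :
    bgGaugeU ek 1 lam (cfg U) = cfg (gaugeAct (fun x => expU1 (ek * lam x)) U) := by
  funext b
  simp only [bgGaugeU, cfg, toC_gaugeAct, toC_expU1, LatticeFieldCalculus.grad, smul_eq_mul, inv_one, one_mul, mul_one]
  rw [← Complex.exp_neg, mul_comm (cexp _) (toC (U b)), mul_assoc, ← Complex.exp_add]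
  congr 1
  push_cast
  ring

/-- The first line of (4.17), scalar half: `ψ(y) → e^{ie_kλ(y)}ψ(y)` IS p34's `twist` by `g = e^{ie_kλ}` ([2] (2.7)).
[cite: BalabanImbrieJaffe1988, (4.17) p.277] -/
theorem bgGaugePhi_eq_twist (ek : ℝ) (lam : Balaban1983to89.Site P j → ℝ) (φ : HiggsField P j) :
    bgGaugePhi ek lam φ = twist (fun x => expU1 (ek * lam x)) φ := by
  funext x
  simp only [bgGaugePhi, twist_apply, toC_expU1]
  rw [mul_comm (φ x)]
  congr 1
  push_cast
  ring_nf

/-- **The third line of (4.17) for one step (`Λ₁^{(j)*} = ∅`, `Q′*` = pull-back to blocks, any spacing `ξ ≠ 0`) IS the gauge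
transformation of `u` by the BLOCK-CONSTANT gauge function `x ↦ e^{ie_kλ(y_x)}`**: `u_b exp[−ie_kξ(∂^ξ(λ∘y))(b)] =
e^{ie_kλ(y_{b₋})}u_be^{−ie_kλ(y_{b₊})}`. [cite: BalabanImbrieJaffe1988, (4.17) p.277] -/
theorem blockGaugeUj_eq_cfg_gaugeAct {ξ : ℝ} (hξ : ξ ≠ 0) (ek : ℝ) (lam : Balaban1983to89.Site P (j+1) → ℝ) (U : GaugeField P j U1) :
    blockGaugeUj ek ξ (fun (μ : Balaban1983to89.Site P (j+1) → ℝ) (x : Balaban1983to89.Site P j) => μ (blockOf x)) ∅ lam (cfg U) =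
      cfg (gaugeAct (fun x => expU1 (ek * lam (blockOf x))) U) := by
  funext b
  simp only [blockGaugeUj, Finset.notMem_empty, if_false, cfg, toC_gaugeAct, toC_expU1, LatticeFieldCalculus.grad, smul_eq_mul]
  rw [show ek * ξ * (ξ⁻¹ * (lam (blockOf b.tgt) - lam (blockOf b.src))) = ek * (lam (blockOf b.tgt) - lam (blockOf b.src)) by
    field_simp]
  rw [← Complex.exp_neg, mul_comm (cexp _) (toC (U b)), mul_assoc, ← Complex.exp_add]
  congr 1
  push_cast
  ring

/-- kernel: a bond INSIDE a block (`y_{b₊} = y_{b₋}`) is not moved by (4.17) — only the bonds crossing a block face (the `B^s(b′)` of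
[2] (2.15)) are. [cite: BalabanImbrieJaffe1988, (4.17) p.277] -/
theorem blockGaugeUj_of_blockOf_eq (ek ξ : ℝ) (lam : Balaban1983to89.Site P (j+1) → ℝ) (u : PBond P j → ℂ) {b : PBond P j}
    (hb : blockOf b.tgt = blockOf b.src) :
    blockGaugeUj ek ξ (fun (μ : Balaban1983to89.Site P (j+1) → ℝ) (x : Balaban1983to89.Site P j) => μ (blockOf x)) ∅ lam u b = u b := by
  simp [blockGaugeUj, LatticeFieldCalculus.grad, hb]

/-! ## §2 *"does not affect the δ-functions giving the axial gauge conditions"* -/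

section AxialGauge

variable {G : Type*} [GaugeGroup G]

/-- kernel: a block-constant gauge transformation CONJUGATES an intra-block bond variable by one group element.
[cite: BalabanImbrieJaffe1988, (4.17) p.277] -/
theorem gaugeAct_blockConst_apply (g : GaugeTransf P (j+1) G) (U : GaugeField P j G) {b : PBond P j}
    (hb : blockOf b.tgt = blockOf b.src) :
    gaugeAct (fun x => g (blockOf x)) U b = g (blockOf b.src) * U b * (g (blockOf b.src))⁻¹ := by
  simp only [GaugeField.gaugeAct, hb]

/-- kernel: on a tree bond of (3.4) (intra-block, `blockOf_tgt`), `u^{g∘y}_b = 1 ⇔ u_b = 1`. [cite: BalabanImbrieJaffe1988, (4.17) p.277] -/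
theorem gaugeAct_blockConst_eq_one_iff (hj : j + 1 ≤ P.m + P.K) (g : GaugeTransf P (j+1) G) (U : GaugeField P j G) {b : PBond P j}
    (hb : IsAxialBond b) : gaugeAct (fun x => g (blockOf x)) U b = 1 ↔ U b = 1 := by
  rw [gaugeAct_blockConst_apply g U (blockOf_tgt hj hb)]
  constructor
  · intro h
    calc U b = (g (blockOf b.src))⁻¹ * (g (blockOf b.src) * U b * (g (blockOf b.src))⁻¹) * g (blockOf b.src) := by group
      _ = 1 := by rw [h]; group
  · intro h
    rw [h, mul_one, mul_inv_cancel]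

/-- **`δ_{Ax}` is invariant under block-constant gauge transformations**: the axial gauge conditions `u_b = 1` on the block trees (3.4)
hold for `u^{g∘y}` iff they hold for `u` (any gauge group; standing range). [cite: BalabanImbrieJaffe1988, (4.17) p.277] -/
theorem deltaAx_gaugeAct_blockConst (hj : j + 1 ≤ P.m + P.K) (g : GaugeTransf P (j+1) G) (U : GaugeField P j G) :
    DeltaAx (gaugeAct (fun x => g (blockOf x)) U) ↔ DeltaAx U :=
  forall₂_congr fun _ hb => gaugeAct_blockConst_eq_one_iff hj g U (mem_axialBonds.1 hb)

/-- kernel: a block-constant gauge transformation COMMUTES with the freezing `u ↦ u[T := 1]` of the tree bonds (instance-generic in the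
decidability of bond equality). [cite: BalabanImbrieJaffe1988, (4.17) p.277] -/
theorem fixBonds_gaugeAct_blockConst {inst : DecidableEq (PBond P j)} (hj : j + 1 ≤ P.m + P.K) (g : GaugeTransf P (j+1) G)
    (U : GaugeField P j G) :
    fixBonds axialBonds (gaugeAct (fun x => g (blockOf x)) U) = gaugeAct (fun x => g (blockOf x)) (fixBonds axialBonds U) := by
  funext b
  by_cases hb : b ∈ (axialBonds : Finset (PBond P j))
  · rw [fixBonds_apply_of_mem hb, gaugeAct_blockConst_apply g _ (blockOf_tgt hj (mem_axialBonds.1 hb)), fixBonds_apply_of_mem hb,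
      mul_one, mul_inv_cancel]
  · rw [fixBonds_apply_of_not_mem hb]
    simp only [GaugeField.gaugeAct, fixBonds_apply_of_not_mem hb]

variable [MeasurableSpace G] [HaarData G] [MeasurableMul₂ G]

/-- **The product Haar measure `𝒟u` is invariant under every gauge transformation** `u_b ↦ g(b₋)u_bg(b₊)^{−1}` (left and right
invariance of Haar measure, bondwise: `AveragingRT.measurePreserving_mulLeft/Right`). [cite: BalabanImbrieJaffe1985, (2.7) p.303] -/
theorem measurePreserving_gaugeAct (u : GaugeTransf P j G) :
    MeasurePreserving (gaugeAct u) (fieldMeasure P j G) (fieldMeasure P j G) := by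
  have h := (AveragingRT.measurePreserving_mulRight (P := P) (j := j) (G := G) (fun b => (u b.tgt)⁻¹)).comp
    (AveragingRT.measurePreserving_mulLeft (P := P) (j := j) (G := G) (fun b => u b.src))
  have hfun : (gaugeAct u : GaugeField P j G → GaugeField P j G) =
      (fun (U : GaugeField P j G) (b : PBond P j) => U b * (u b.tgt)⁻¹) ∘
        (fun (U : GaugeField P j G) (b : PBond P j) => u b.src * U b) := by
    funext U b
    rfl
  rw [hfun]
  exact h

/-- kernel: the gauge transformations (2.7) are measurable maps of the configuration space. [cite: BalabanImbrieJaffe1985, (2.7) p.303] -/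
theorem measurable_gaugeAct (u : GaugeTransf P j G) : Measurable (gaugeAct u : GaugeField P j G → GaugeField P j G) :=
  (measurePreserving_gaugeAct u).measurable

/-- kernel: `∫𝒟u F(u^g) = ∫𝒟u F(u)` for every integrand (a measurable equivalence; no measurability of `F` needed).
[cite: BalabanImbrieJaffe1985, (2.7) p.303] -/
theorem integral_comp_gaugeAct {E : Type*} [NormedAddCommGroup E] [NormedSpace ℝ E] (u : GaugeTransf P j G) (F : GaugeField P j G → E) :
    ∫ U, F (gaugeAct u U) ∂fieldMeasure P j G = ∫ U, F U ∂fieldMeasure P j G := by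
  let e : GaugeField P j G ≃ᵐ GaugeField P j G :=
    MeasurableEquiv.piCongrRight fun b : PBond P j =>
      (MeasurableEquiv.mulLeft (u b.src)).trans (MeasurableEquiv.mulRight ((u b.tgt)⁻¹))
  have he : (e : GaugeField P j G → GaugeField P j G) = gaugeAct u := by
    funext U b
    rfl
  have hmp : MeasurePreserving e (fieldMeasure P j G) (fieldMeasure P j G) := by
    rw [he]
    exact measurePreserving_gaugeAct u
  have h := hmp.integral_comp' F
  rw [he] at h
  exact h

/-- kernel: `∫𝒟u δ_{Ax}(u)(·)` is invariant under block-constant gauge transformations — instance-generic form over the freezing map.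
[cite: BalabanImbrieJaffe1988, (4.17) p.277] -/
theorem map_gaugeAct_blockConst_map_fixBonds {inst : DecidableEq (PBond P j)} (hj : j + 1 ≤ P.m + P.K) (g : GaugeTransf P (j+1) G) :
    ((fieldMeasure P j G).map (fixBonds axialBonds)).map (gaugeAct (fun x => g (blockOf x))) =
      (fieldMeasure P j G).map (fixBonds axialBonds) := by
  have hfix : Measurable (fixBonds (axialBonds : Finset (PBond P j)) : GaugeField P j G → GaugeField P j G) :=
    @measurable_fixBonds P j G _ _ inst axialBonds
  have hga : Measurable (gaugeAct (fun x => g (blockOf x)) : GaugeField P j G → GaugeField P j G) := measurable_gaugeAct _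
  rw [Measure.map_map hga hfix]
  have e : (gaugeAct (fun x => g (blockOf x)) ∘ fixBonds (axialBonds : Finset (PBond P j))) =
      fixBonds axialBonds ∘ (gaugeAct (fun x => g (blockOf x)) : GaugeField P j G → GaugeField P j G) := by
    funext U
    exact (fixBonds_gaugeAct_blockConst hj g U).symm
  rw [e, ← Measure.map_map hfix hga, (measurePreserving_gaugeAct _).map_eq]

/-- **`∫𝒟u δ_{Ax}(u)(·)` is invariant under block-constant gauge transformations**: `(∫𝒟u δ_{Ax}).map (u ↦ u^{g∘y}) = ∫𝒟u δ_{Ax}` — the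
measure-level content of *"does not affect the δ-functions giving the axial gauge conditions"* (standing range; any gauge group).
[cite: BalabanImbrieJaffe1988, (4.17) p.277] -/
theorem map_gaugeAct_blockConst_axialMeasure (hj : j + 1 ≤ P.m + P.K) (g : GaugeTransf P (j+1) G) :
    (axialMeasure P j G).map (gaugeAct (fun x => g (blockOf x))) = axialMeasure P j G := by
  unfold axialMeasure
  exact map_gaugeAct_blockConst_map_fixBonds hj g

/-- kernel: the same as a measure-preserving map. [cite: BalabanImbrieJaffe1988, (4.17) p.277] -/
theorem measurePreserving_gaugeAct_blockConst_axialMeasure (hj : j + 1 ≤ P.m + P.K) (g : GaugeTransf P (j+1) G) :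
    MeasurePreserving (gaugeAct (fun x => g (blockOf x))) (axialMeasure P j G) (axialMeasure P j G) :=
  ⟨measurable_gaugeAct _, map_gaugeAct_blockConst_axialMeasure hj g⟩

/-- kernel: `∫𝒟u δ_{Ax}(u) F(u^{g∘y}) = ∫𝒟u δ_{Ax}(u) F(u)` for every integrand. [cite: BalabanImbrieJaffe1988, (4.17) p.277] -/
theorem integral_comp_gaugeAct_blockConst_axialMeasure {E : Type*} [NormedAddCommGroup E] [NormedSpace ℝ E]
    (hj : j + 1 ≤ P.m + P.K) (g : GaugeTransf P (j+1) G) (F : GaugeField P j G → E) :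
    ∫ U, F (gaugeAct (fun x => g (blockOf x)) U) ∂axialMeasure P j G = ∫ U, F U ∂axialMeasure P j G := by
  let e : GaugeField P j G ≃ᵐ GaugeField P j G :=
    MeasurableEquiv.piCongrRight fun b : PBond P j =>
      (MeasurableEquiv.mulLeft (g (blockOf b.src))).trans (MeasurableEquiv.mulRight ((g (blockOf b.tgt))⁻¹))
  have he : (e : GaugeField P j G → GaugeField P j G) = gaugeAct (fun x => g (blockOf x)) := by
    funext U b
    rfl
  have hmp : MeasurePreserving e (axialMeasure P j G) (axialMeasure P j G) := by
    rw [he]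
    exact measurePreserving_gaugeAct_blockConst_axialMeasure hj g
  have h := hmp.integral_comp' F
  rw [he] at h
  exact h

end AxialGauge

/-! ## §3 *"and gauge field renormalization transformations"*: `δ(v/Qu)` and `δ_H(ψ − Q(u)φ)` -/

/-- kernel: the gauge transformation (2.7) by `h^{−1}` undoes the one by `h` on gauge fields. [cite: BalabanImbrieJaffe1985, (2.7) p.303] -/
theorem gaugeAct_inv_gaugeAct {G : Type*} [GaugeGroup G] (u : GaugeTransf P j G) (U : GaugeField P j G) :
    gaugeAct (fun x => (u x)⁻¹) (gaugeAct u U) = U := by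
  funext b
  simp only [GaugeField.gaugeAct, inv_inv]
  group

/-- kernel: … and on scalar fields, `h^{−1}(hφ) = φ`. [cite: BalabanImbrieJaffe1985, (2.7) p.303] -/
theorem twist_inv_twist (g : GaugeTransf P j U1) (φ : HiggsField P j) : twist (fun x => (g x)⁻¹) (twist g φ) = φ := by
  funext x
  simp only [twist_apply, toC_inv']
  rw [← mul_assoc, inv_mul_cancel₀ (toC_ne_zero _), one_mul]

/-- kernel: `𝒟φ` is invariant under the rotations `φ ↦ gφ`: `∫𝒟φ F(gφ) = ∫𝒟φ F(φ)` for every integrand (p34's `measurePreserving_twist`;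
here through r18's measurable equivalence `rotField`). [cite: BalabanImbrieJaffe1985, (2.7) p.303] -/
theorem integral_comp_twist {E : Type*} [NormedAddCommGroup E] [NormedSpace ℝ E] (g : GaugeTransf P j U1) (F : HiggsField P j → E) :
    ∫ φ, F (twist g φ) = ∫ φ, F φ := by
  have he : (rotField g : HiggsField P j → HiggsField P j) = twist g := by
    funext φ
    rw [rotField_apply]
    rfl
  have h := (measurePreserving_rotField g).integral_comp' F
  rw [he] at h
  exact h

/-- **`δ(v/Qu)` is invariant**: `Q(u^{g∘y}) = (Qu)^g` — the block average (2.10) of the block-gauge transformed `u` is the gauge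
transform by `g` of `Qu` (r18's `qU_gaugeAct` with the gauge function `g∘y` evaluated at the block corners; standing range).
[cite: BalabanImbrieJaffe1988, (4.17) p.277] -/
theorem qU_gaugeAct_blockConst (hj : j + 1 ≤ P.m + P.K) (g : GaugeTransf P (j+1) U1) (U : GaugeField P j U1) :
    qU (gaugeAct (fun x => g (blockOf x)) U) = gaugeAct g (qU U) := by
  rw [qU_gaugeAct hj]
  simp_rw [blockOf_corner hj]

/-- **the centre of `δ_H` rotates with `ψ`**: `Q(u^{g∘y})((g∘y)φ) = g·Q(u)φ` ([2] (2.8) `qCov_gaugeAct` at the corners; standing range).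
[cite: BalabanImbrieJaffe1988, (4.17) p.277] -/
theorem qCov_gaugeAct_blockConst (hj : j + 1 ≤ P.m + P.K) (g : GaugeTransf P (j+1) U1) (U : GaugeField P j U1) (φ : HiggsField P j) :
    qCov (gaugeAct (fun x => g (blockOf x)) U) (twist (fun x => g (blockOf x)) φ) = twist g (qCov U φ) := by
  funext y
  show qCov (gaugeAct (fun x => g (blockOf x)) U) (fun x => toC (g (blockOf x)) * φ x) y = _
  rw [qCov_gaugeAct hj, blockOf_corner hj, twist_apply]

/-- **the `ψ`-Gaussian of (3.11) is rotation invariant**: `exp(−½aL⁻²⟨gψ − gc, gψ − gc⟩ − E^{(0)}) = exp(−½aL⁻²⟨ψ − c, ψ − c⟩ − E^{(0)})`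
(`|g(y)| = 1`). [cite: BalabanImbrieJaffe1988, (3.11) p.266] -/
theorem gaussWeight_twist (a : ℝ) (g : GaugeTransf P (j+1) U1) (c ψ : HiggsField P (j+1)) :
    gaussWeight a (twist g c) (twist g ψ) = gaussWeight a c ψ := by
  unfold gaussWeight
  congr 3
  refine sum_congr rfl fun y _ => ?_
  rw [twist_apply, twist_apply, ← mul_sub, norm_mul, norm_toC, one_mul]

/-! ## §4 THE THEOREM: block field gauge invariance of the renormalization transformation (3.11) -/

/-- **Block field gauge invariance of (3.11)** (p. 277: *"and thus we have invariance in the previous sense. Here, however, the variables u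
and u^{(j)} are also transformed, but in a way that does not affect the δ-functions giving the axial gauge conditions and gauge field
renormalization transformations"*) — one step on the torus of record, PROVED: if `ρ₀(u, φ)` is jointly gauge invariant ([2] (2.7):
`ρ₀(u^h, hφ) = ρ₀(u, φ)`) and `ρ₁` is a (3.11)-density of `ρ₀` for the concrete block averages (2.6)/(2.10) (`IsRT311 qU qCov a ρ₀ ρ₁`), then
for every `g : T₁^{(1)} → U(1)` the transformed density `(v, ψ) ↦ ρ₁(v^g, gψ)` is again a (3.11)-density of `ρ₀`.  Mechanism: substitute
`v → v^g`, `ψ → gψ` (`dv`, `dψ` invariant), then `u → u^{g∘y}` (`𝒟u δ_{Ax}` invariant, §2), `φ → (g∘y)φ` (`𝒟φ` invariant); `Q(u^{g∘y}) = (Qu)^g`,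
`Q(u^{g∘y})((g∘y)φ) = gQ(u)φ` (§3) and the rotation invariance of the `ψ`-Gaussian close the computation.  Standing range; no measurability
or integrability hypothesis on `ρ₀`, `ρ₁` is needed. [cite: BalabanImbrieJaffe1988, (4.17) p.277] -/
theorem isRT311_blockGauge (hj : j + 1 ≤ P.m + P.K) {a : ℝ} {ρ₀ : GaugeField P j U1 → HiggsField P j → ℂ}
    {ρ₁ : GaugeField P (j+1) U1 → HiggsField P (j+1) → ℂ} (h : IsRT311 qU qCov a ρ₀ ρ₁) (hρg : JointInvariant ρ₀)
    (g : GaugeTransf P (j+1) U1) :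
    IsRT311 qU qCov a ρ₀ (fun v ψ => ρ₁ (gaugeAct g v) (twist g ψ)) := by
  intro t ht hb
  -- the inverse transformation on the block fields
  set gi : GaugeTransf P (j+1) U1 := fun y => (g y)⁻¹ with hgi
  have hmeas : Measurable fun z : GaugeField P (j+1) U1 × HiggsField P (j+1) => t (gaugeAct gi z.1, twist gi z.2) :=
    ht.comp (((measurable_gaugeAct gi).comp measurable_fst).prodMk ((measurable_twist gi).comp measurable_snd))
  have hbdd : ∃ C : ℝ, ∀ z : GaugeField P (j+1) U1 × HiggsField P (j+1), ‖t (gaugeAct gi z.1, twist gi z.2)‖ ≤ C := by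
    obtain ⟨C, hC⟩ := hb
    exact ⟨C, fun z => hC _⟩
  -- Step 1: move the transformation from `ρ₁` to the test function (`dv`, `dψ` invariant)
  have step1 : ∫ v, ∫ ψ, ρ₁ (gaugeAct g v) (twist g ψ) * t (v, ψ) ∂volume ∂fieldMeasure P (j+1) U1 =
      ∫ v, ∫ ψ, ρ₁ v ψ * t (gaugeAct gi v, twist gi ψ) ∂volume ∂fieldMeasure P (j+1) U1 := by
    rw [← integral_comp_gaugeAct g (fun v => ∫ ψ, ρ₁ v ψ * t (gaugeAct gi v, twist gi ψ))]
    refine integral_congr_ae (ae_of_all _ fun v => ?_)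
    simp only [hgi, gaugeAct_inv_gaugeAct]
    rw [← integral_comp_twist g (fun ψ => ρ₁ (gaugeAct g v) ψ * t (v, twist (fun y => (g y)⁻¹) ψ))]
    simp only [twist_inv_twist]
  rw [step1]
  -- Step 2: (3.11) for `ρ₁` against the transformed test function
  have h2 := h _ hmeas hbdd
  simp only at h2
  rw [h2]
  -- Step 3: `u → u^{g∘y}` under `∫𝒟u δ_{Ax}`
  rw [← integral_comp_gaugeAct_blockConst_axialMeasure hj g (fun U => ∫ φ, ∫ ψ,
    ρ₀ U φ * (gaussWeight a (qCov U φ) ψ : ℂ) * t (gaugeAct gi (qU U), twist gi ψ))]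
  refine integral_congr_ae (ae_of_all _ fun U => ?_)
  simp only [qU_gaugeAct_blockConst hj, hgi, gaugeAct_inv_gaugeAct]
  -- Step 4: `φ → (g∘y)φ` under `𝒟φ`
  rw [← integral_comp_twist (fun x => g (blockOf x)) (fun φ => ∫ ψ,
    ρ₀ (gaugeAct (fun x => g (blockOf x)) U) φ * (gaussWeight a (qCov (gaugeAct (fun x => g (blockOf x)) U) φ) ψ : ℂ) *
      t (qU U, twist (fun y => (g y)⁻¹) ψ))]
  refine integral_congr_ae (ae_of_all _ fun φ => ?_)
  simp only [hρg (fun x => g (blockOf x)) U φ, qCov_gaugeAct_blockConst hj]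
  -- Step 5: `ψ → gψ` under `dψ`
  rw [← integral_comp_twist g (fun ψ => ρ₀ U φ * (gaussWeight a (twist g (qCov U φ)) ψ : ℂ) * t (qU U, twist (fun y => (g y)⁻¹) ψ))]
  simp only [gaussWeight_twist, twist_inv_twist]

/-- **Block field gauge invariance of the CONSTRUCTED first density of the printed model**: for the observables of (3.1) (`F` jointly
measurable, jointly gauge invariant, `|F(u, φ)| ≤ CΠ_x(1 + |φ(x)|)ⁿ`), `ε > 0`, `λ > 0`, `a > 0`, `d ≥ 2` (standing range), the density
`ρ₁^L := 𝒯ρ₀` of r18's `isRT311_printed` transformed by any block field gauge transformation `(v, ψ) ↦ (v^g, gψ)` is again a (3.11)-density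
of `ρ₀ = F e^{−S}`. [cite: BalabanImbrieJaffe1988, (4.17) p.277] -/
theorem isRT311_printed_blockGauge (hj : j + 1 ≤ P.m + P.K) (hd : 2 ≤ P.d) {a ε : ℝ} (ha : 0 < a) (hε : 0 < ε) (e : ℝ) {lam : ℝ}
    (hlam : 0 < lam) (dm2 E₀ E₁ : ℝ) {F : GaugeField P j U1 → HiggsField P j → ℂ} (hFm : Measurable (Function.uncurry F))
    (hFg : JointInvariant F) {C : ℝ} {n : ℕ}
    (hF : ∀ U φ, ‖F U φ‖ ≤ C * ∏ x : Balaban1983to89.Site P j, (1 + ‖φ x‖) ^ n) (g : GaugeTransf P (j+1) U1) :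
    IsRT311 qU qCov a (rho0 ε e lam dm2 E₀ E₁ F)
      (fun v ψ => (torusRTData hj).rt (gaussApprox ha hd) (rho0 ε e lam dm2 E₀ E₁ F) (gaugeAct g v) (twist g ψ)) :=
  isRT311_blockGauge hj (isRT311_printed hj hd ha hε e hlam dm2 E₀ E₁ hFm hFg hF)
    (fun k U φ => BIJ88RenormTransf311.rho0_gaugeAct ε e lam dm2 E₀ E₁ hFg k U φ) g

/-! ## §5 (v1.1) (3.11) determines `ρ₁^L` almost everywhere; block field gauge invariance of the constructed density, a.e. -/

/-- **(3.11) DETERMINES `ρ₁^L(v, ψ)` `dv dψ`-almost everywhere** (the definite article of p. 266 *"the first renormalization transformation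
… ρ₁^L(v, ψ) = …"* in the push-forward reading): two `dv dψ`-integrable functions satisfying `IsRT311 qU qCov a ρ₀ ·` for the same `ρ₀`
agree almost everywhere — test (3.11) against indicators of measurable sets and use Fubini. [cite: BalabanImbrieJaffe1988, (3.11) p.266] -/
theorem isRT311_unique {a : ℝ} {ρ₀ : GaugeField P j U1 → HiggsField P j → ℂ} {ρ₁ ρ₁' : GaugeField P (j+1) U1 → HiggsField P (j+1) → ℂ}
    (h : IsRT311 qU qCov a ρ₀ ρ₁) (h' : IsRT311 qU qCov a ρ₀ ρ₁')
    (hi : Integrable (Function.uncurry ρ₁) ((fieldMeasure P (j+1) U1).prod volume))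
    (hi' : Integrable (Function.uncurry ρ₁') ((fieldMeasure P (j+1) U1).prod volume)) :
    Function.uncurry ρ₁ =ᵐ[(fieldMeasure P (j+1) U1).prod volume] Function.uncurry ρ₁' := by
  refine hi.ae_eq_of_forall_setIntegral_eq _ _ hi' fun S hS _ => ?_
  have ht : Measurable (S.indicator fun _ => (1 : ℂ)) := measurable_const.indicator hS
  have hb : ∃ C : ℝ, ∀ z, ‖S.indicator (fun _ => (1 : ℂ)) z‖ ≤ C :=
    ⟨1, fun z => by by_cases hz : z ∈ S <;> simp [hz]⟩
  have key : ∀ {ρ : GaugeField P (j+1) U1 → HiggsField P (j+1) → ℂ},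
      Integrable (Function.uncurry ρ) ((fieldMeasure P (j+1) U1).prod volume) →
      ∫ z in S, Function.uncurry ρ z ∂(fieldMeasure P (j+1) U1).prod volume =
        ∫ v, ∫ ψ, ρ v ψ * S.indicator (fun _ => (1 : ℂ)) (v, ψ) ∂volume ∂fieldMeasure P (j+1) U1 := by
    intro ρ hρ
    rw [← integral_indicator hS, integral_prod _ (hρ.indicator hS)]
    refine integral_congr_ae (ae_of_all _ fun v => integral_congr_ae (ae_of_all _ fun ψ => ?_))
    by_cases hz : (v, ψ) ∈ S
    · simp [Set.indicator_of_mem hz]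
    · simp [Set.indicator_of_notMem hz]
  rw [key hi, key hi', h _ ht hb, h' _ ht hb]

/-- kernel: a block field gauge transformation `(v, ψ) ↦ (v^g, gψ)` PRESERVES `dv dψ` (product Haar measure × Lebesgue measure).
[cite: BalabanImbrieJaffe1988, (4.17) p.277] -/
theorem measurePreserving_blockGauge (g : GaugeTransf P (j+1) U1) :
    MeasurePreserving (fun z : GaugeField P (j+1) U1 × HiggsField P (j+1) => (gaugeAct g z.1, twist g z.2))
      ((fieldMeasure P (j+1) U1).prod volume) ((fieldMeasure P (j+1) U1).prod volume) :=
  (measurePreserving_gaugeAct g).prod (BIJ85RT33.measurePreserving_twist g)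

/-- **Block field gauge invariance of the constructed first density, almost everywhere.**  For `a > 0`, `d ≥ 2` (standing range) and a
density `ρ₀(u, φ)` that is jointly measurable, jointly gauge invariant and `𝒟u𝒟φ`-integrable, the Radon–Nikodym version `ρ₁^L := 𝒯ρ₀` of
(3.11) over the printed block averages (r18's `torusRTData`, p34's `RTData.rt`) satisfies `ρ₁^L(v^g, gψ) = ρ₁^L(v, ψ)` for `dv dψ`-almost
every `(v, ψ)`, for every `g : T₁^{(1)} → U(1)` — (4.17) p. 277 *"leave each expression invariant"* for the first renormalized density, in the
only sense available for a density defined almost everywhere (`isRT311_blockGauge` + `isRT311_unique`). [cite: BalabanImbrieJaffe1988, (4.17) p.277] -/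
theorem rt_blockGauge_ae_eq (hj : j + 1 ≤ P.m + P.K) {a : ℝ} (ha : 0 < a) (hd : 2 ≤ P.d)
    {ρ₀ : GaugeField P j U1 → HiggsField P j → ℂ} (hρm : Measurable (Function.uncurry ρ₀)) (hρg : JointInvariant ρ₀)
    (hρi : Integrable (Function.uncurry ρ₀) ((fieldMeasure P j U1).prod volume)) (g : GaugeTransf P (j+1) U1) :
    (fun z : GaugeField P (j+1) U1 × HiggsField P (j+1) =>
        (torusRTData hj).rt (gaussApprox ha hd) ρ₀ (gaugeAct g z.1) (twist g z.2)) =ᵐ[(fieldMeasure P (j+1) U1).prod volume]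
      Function.uncurry ((torusRTData hj).rt (gaussApprox ha hd) ρ₀) := by
  have h1 : IsRT311 qU qCov a ρ₀ ((torusRTData hj).rt (gaussApprox ha hd) ρ₀) :=
    BIJ85BlockAveragesTorus.isRT311_model hj ha hd hρm hρg hρi
  have hi : Integrable (Function.uncurry ((torusRTData hj).rt (gaussApprox ha hd) ρ₀)) ((fieldMeasure P (j+1) U1).prod volume) :=
    BIJ85RT37Normalization.integrable_rt (D := torusRTData hj) (A := gaussApprox ha hd) hρm hρg hρi
  have hi' : Integrable (Function.uncurry fun v ψ => (torusRTData hj).rt (gaussApprox ha hd) ρ₀ (gaugeAct g v) (twist g ψ))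
      ((fieldMeasure P (j+1) U1).prod volume) :=
    ((measurePreserving_blockGauge g).integrable_comp hi.aestronglyMeasurable).2 hi
  exact (isRT311_unique (isRT311_blockGauge hj h1 hρg g) h1 hi' hi :)

/-! ## §6 (v1.2) *"the above transformations induce the gauge transformation u_{k,b} → u_{k,b}exp[−ie_kη(∂^ηQ′*_kλ)]"* — the U(1)/(4.2)
reading of p31's group-level mechanism `BIJ85Eq453GaugeField.qsstarG_gaugeAct` / `qsstarGIter_gaugeAct` -/

/-- kernel: the third line of (4.17) with empty exempt region, for a general ℂ-valued bond field and the pull-back `Q′*` along ANY map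
`π` of sites (one step: `π = blockOf`; k steps: `π = blockOfIter k`), IS the phase gauge transformation of Sect. 3 with parameter
`e_k·(λ∘π)` (any spacing `ξ ≠ 0`). [cite: BalabanImbrieJaffe1988, (4.17) p.277] -/
theorem blockGaugeUj_empty_eq_gaugeU {k : ℕ} {ξ : ℝ} (hξ : ξ ≠ 0) (ek : ℝ) (π : Balaban1983to89.Site P j → Balaban1983to89.Site P k)
    (lam : Balaban1983to89.Site P k → ℝ) (u : PBond P j → ℂ) :
    blockGaugeUj ek ξ (fun (μ : Balaban1983to89.Site P k → ℝ) (x : Balaban1983to89.Site P j) => μ (π x)) ∅ lam u =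
      gaugeU (fun x => ek * lam (π x)) u := by
  have h := BIJ88Sect4Statements.bgGaugeU_eq (ek := ek) hξ (fun x => lam (π x)) u
  rw [← h]
  funext b
  simp [blockGaugeUj, bgGaugeU]

/-- kernel: the plaquette field strength `f^{(k)}(p) = (ie_k)⁻¹log u(p)` entering the exponent of (4.2) is gauge invariant (`u(p)` is),
so the block field gauge transformation of `u` leaves the correction term `𝒟_{k,loc}∂^*Q^{e*}_kf^{(k)}` of (4.2) unchanged.
[cite: BalabanImbrieJaffe1988, (4.2) p.274] -/
theorem fieldStrength_plaqVar_gaugeAct (e₀ : ℝ) (g : GaugeTransf P j U1) (U : GaugeField P j U1) (p : Balaban1983to89.Plaq P j) :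
    fieldStrength e₀ (plaqVar (cfg (gaugeAct g U)) p) = fieldStrength e₀ (plaqVar (cfg U) p) := by
  rw [BIJ88RenormTransf311.cfg_gaugeAct, plaqVar_gauge]

/-- **The induced transformation of the background field (4.2), one step**: transforming the unit-lattice field `v ↦ v^g` transforms
`u_k = (Q^{s*}v)·exp(−ie_kη·corr)` (r18's `backgroundU` over the ℂ-reading of p31's group-level `Q^{s*}` = [2] (4.5.3) `qsstarG`; the
correction `corr = 𝒟_{k,loc}∂^*Q^{e*}_kf^{(k)}` unchanged, `fieldStrength_plaqVar_gaugeAct`) by the block-constant gauge transformation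
`g∘y`: `u_{k,b} ↦ g(y_{b₋})u_{k,b}g(y_{b₊})^{−1}` (p31's `qsstarG_gaugeAct`; standing range). [cite: BalabanImbrieJaffe1988, (4.17) p.277] -/
theorem backgroundU_qsstarG_gaugeAct (hj : j + 1 ≤ P.m + P.K) (ek η : ℝ) (g : GaugeTransf P (j+1) U1) (V : GaugeField P (j+1) U1)
    (corr : PBond P j → ℝ) :
    backgroundU ek η (cfg (BIJ85Eq453GaugeField.qsstarG (gaugeAct g V))) corr =
      fun b => toC (g (blockOf b.src)) * backgroundU ek η (cfg (BIJ85Eq453GaugeField.qsstarG V)) corr b * (toC (g (blockOf b.tgt)))⁻¹ := by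
  funext b
  simp only [backgroundU, cfg, BIJ85Eq453GaugeField.qsstarG_gaugeAct hj, toC_gaugeAct]
  ring

/-- **p. 277, verbatim: *"The dependence of u_k and u and the u^{(j)} is such that the above transformations induce the gauge transformation
u_{k,b} → u_{k,b}exp[−ie_kη(∂^ηQ′*_kλ)]"* — PROVED for the background part of (4.2) at one step**: with `v ↦ v^g`, `g = e^{ie_kλ}` (the first
line of (4.17), `bgGaugeU_one_eq_cfg_gaugeAct`), the background `u_k` built from `Q^{s*}v` undergoes exactly the third-line transformation of
(4.17) with `Q′*` = pull-back to blocks (any `ξ ≠ 0`; the print has `ξ = η`). [cite: BalabanImbrieJaffe1988, (4.17) p.277] -/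
theorem backgroundU_blockGauge (hj : j + 1 ≤ P.m + P.K) {ξ : ℝ} (hξ : ξ ≠ 0) (ek η : ℝ) (lam : Balaban1983to89.Site P (j+1) → ℝ)
    (V : GaugeField P (j+1) U1) (corr : PBond P j → ℝ) :
    backgroundU ek η (cfg (BIJ85Eq453GaugeField.qsstarG (gaugeAct (fun y => expU1 (ek * lam y)) V))) corr =
      blockGaugeUj ek ξ (fun (μ : Balaban1983to89.Site P (j+1) → ℝ) (x : Balaban1983to89.Site P j) => μ (blockOf x)) ∅ lam
        (backgroundU ek η (cfg (BIJ85Eq453GaugeField.qsstarG V)) corr) := by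
  rw [backgroundU_qsstarG_gaugeAct hj, blockGaugeUj_empty_eq_gaugeU hξ]
  funext b
  simp only [gaugeU, toC_expU1, ← Complex.exp_neg]

/-- **The same for k steps** (`Q^{s*}_k` = p31's `qsstarGIter k`, `Q′*_k` = pull-back along `blockOfIter k`): `v ↦ v^g` on `T^{(i+k)}` induces
on `u_k = (Q^{s*}_kv)·exp(−ie_kη·corr)` the conjugation by `g∘y^k` (p31's `qsstarGIter_gaugeAct`), i.e. the third line of (4.17) with
`Q′*_k` (standing range). [cite: BalabanImbrieJaffe1988, (4.17) p.277] -/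
theorem backgroundU_qsstarGIter_gaugeAct {i k : ℕ} (hk : i + k ≤ P.m + P.K) (ek η : ℝ) (g : GaugeTransf P (i+k) U1)
    (V : GaugeField P (i+k) U1) (corr : PBond P i → ℝ) :
    backgroundU ek η (cfg (BIJ85Eq453GaugeField.qsstarGIter k (gaugeAct g V))) corr =
      fun b => toC (g (blockOfIter k b.src)) * backgroundU ek η (cfg (BIJ85Eq453GaugeField.qsstarGIter k V)) corr b *
        (toC (g (blockOfIter k b.tgt)))⁻¹ := by
  funext b
  simp only [backgroundU, cfg, BIJ85Eq453GaugeField.qsstarGIter_gaugeAct k hk, toC_gaugeAct]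
  ring

/-- **k steps, printed form**: `u_{k,b} → u_{k,b}exp[−ie_kξ(∂^ξQ′*_kλ)(b)]` with `Q′*_kλ = λ∘y^k` (any `ξ ≠ 0`; print: `ξ = η`).
[cite: BalabanImbrieJaffe1988, (4.17) p.277] -/
theorem backgroundU_blockGauge_iter {i k : ℕ} (hk : i + k ≤ P.m + P.K) {ξ : ℝ} (hξ : ξ ≠ 0) (ek η : ℝ)
    (lam : Balaban1983to89.Site P (i+k) → ℝ) (V : GaugeField P (i+k) U1) (corr : PBond P i → ℝ) :
    backgroundU ek η (cfg (BIJ85Eq453GaugeField.qsstarGIter k (gaugeAct (fun y => expU1 (ek * lam y)) V))) corr =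
      blockGaugeUj ek ξ (fun (μ : Balaban1983to89.Site P (i+k) → ℝ) (x : Balaban1983to89.Site P i) => μ (blockOfIter k x)) ∅ lam
        (backgroundU ek η (cfg (BIJ85Eq453GaugeField.qsstarGIter k V)) corr) := by
  rw [backgroundU_qsstarGIter_gaugeAct hk, blockGaugeUj_empty_eq_gaugeU hξ]
  funext b
  simp only [gaugeU, toC_expU1, ← Complex.exp_neg]

end

end Literature.MathematicalPhysics.QuantumFieldTheory.BalabanImbrieJaffe1984to88.BIJ88BlockGauge417
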